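import Summits.ValiantsHypothesis.ValiantsHypothesis.Theorems.AnyonJetsJetConstantElimVP0Collapse
import Summits.ValiantsHypothesis.ValiantsHypothesis.Theorems.AnyonJetsJetConstantElimMultiplierRemovalCalibration
import Summits.ValiantsHypothesis.ValiantsHypothesis.Theorems.AnyonJetsJetConstantElimTwoAdicBridges

/-!
# AnyonJets — `VP⁰ = VNP⁰` versus the route items: the stub `stub_multiplierRemoval`, the cruxes
# `JetConstantElim` (16737), `JetConstantElimTwoAdic` (23655), `ConstantFreeJetGrowth` (16738),
# `ConstantFreeJetGrowthUltimate` (23656) and the support `PerModPowBooleanHard` (16743)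

Consequences BY NAME of `uniformTau_of_vp0EqVNP0` (`AnyonJetsJetConstantElimVP0Collapse.lean`:
under the tree's `VP0EqVNP0` every anyonic jet has `τ(J_(n,k)) ≤ (n+2)^c`, uniformly in `k`):

* `multiplierRemoval_of_vp0EqVNP0` — **`VP⁰ = VNP⁰ ⟹ stub_multiplierRemoval`** (signature
  verbatim; line `birth` of crux 16737);
* `jetConstantElim_of_vp0EqVNP0` (item 16737), `jetConstantElimTwoAdic_of_vp0EqVNP0` (item 23655,
  the binder of the re-glued `closes`);
* `not_constantFreeJetGrowth_of_vp0EqVNP0` (item 16738),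
  `not_constantFreeJetGrowthUltimate_of_vp0EqVNP0` (item 23656, the residual),
  `not_perModPowBooleanHard_of_vp0EqVNP0` (support 16743);
* contrapositives: `not_vp0EqVNP0_of_not_multiplierRemoval` — **a refutation of the stub proves
  `VP⁰ ≠ VNP⁰`**; `not_vp0EqVNP0_of_not_jetConstantElim`,
  `not_vp0EqVNP0_of_not_jetConstantElimTwoAdic` — so does a refutation of either CE-side crux;
  `not_vp0EqVNP0_of_constantFreeJetGrowth`, `not_vp0EqVNP0_of_constantFreeJetGrowthUltimate` —
  either CF-side crux PROVES `VP⁰ ≠ VNP⁰`.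

Reading, with the landed lower half (`not_isPBounded_tau_per_of_multiplierRemoval_of_cfGrowth`:
`MR ∧ CF ⊢ τ(PER) ≠ n^{O(1)}`): the stub is LOCKED BOTH WAYS — refuting it separates `VP⁰` from
`VNP⁰`, proving it (together with the sibling crux the route needs anyway) proves a superpolynomial
constant-free lower bound for the permanent.  For the binder 23655 the same lock reads:
`VP⁰ = VNP⁰ ⟹ 23655` (here) and `23655 ∧ 23656 ∧ U ⟹ VH` (`valiant_of_ultimateItems`).
Honest framing: conditional implications only; every item named stays OPEN; VP ≠ VNP is NOT proved
here and is not moved.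
-/

noncomputable section

-- single-conjunct layout: Sub = Summit, duplicated namespace component intended
set_option linter.dupNamespace false

namespace Summit.ValiantsHypothesis.ValiantsHypothesis.Theorems.AnyonJets.JetConstantElim

open MvPolynomial Finset Literature.Computability.AlgebraicComplexity
open Literature.Barriers.ValiantsHypothesis (VP0EqVNP0)
open Summit.ValiantsHypothesis.ValiantsHypothesis.Theses.AnyonJets
open Summit.ValiantsHypothesis.ValiantsHypothesis.Theorems.AnyonJets.ConstantFreeJetGrowth (jet)

/-! ### The sharper lock: the inversion pencil itself

`uniformTau_of_vp0EqVNP0` uses the collapse only to bound `τ(P_n)`; the bound on the jets follows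
from `τ(P_n) = n^{O(1)}` alone.  Contrapositively, a refutation of uniform cheapness (e.g. of the
stub) proves an explicit superpolynomial constant-free LOWER bound for the one `VNP⁰` family
`P_n(q;X) = Σ_σ q^{inv σ} Π X_{σ i,i}`. -/

/-- **`τ(P_n) = n^{O(1)} ⟹ ∃ c ∀ n k, τ(J_(n,k)) ≤ (n+2)^c`**: uniform cheapness of all anyonic
jets follows from constant-free cheapness of the inversion pencil alone (`tau_jet_le_pencil`,
`bound_arith`, `AnyonJets.jet_eq_zero_of_lt`).
[cite: BurgisserClausenShokrollahi1997, Lemma (21.25)] -/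
theorem uniformTau_of_isPBounded_tau_pencil
    (hP : IsPBounded fun n => constantFreeComplexity
      (∑ σ : Equiv.Perm (Fin n), (X none : MvPolynomial (Option (Fin n × Fin n)) ℤ) ^
          (univ.filter (fun p : Fin n × Fin n => p.1 < p.2 ∧ σ p.2 < σ p.1)).card *
        ∏ i : Fin n, X (some (σ i, i)))) :
    ∃ c : ℕ, ∀ n k : ℕ, constantFreeComplexity (jet n k) ≤ (n + 2) ^ c := by
  obtain ⟨a, b, hab⟩ := (IsPBounded.iff_exists_le_mul_succ_pow _).1 hP
  refine ⟨a + b + 7, fun n k => ?_⟩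
  rcases Nat.lt_or_ge (n * (n - 1) / 2) k with hk | hk
  · have h0 : jet n k = 0 := AnyonJets.jet_eq_zero_of_lt hk
    rw [h0, constantFreeComplexity_zero]; exact Nat.zero_le _
  · calc constantFreeComplexity (jet n k)
        ≤ (n + k + 2) ^ 2 * (constantFreeComplexity (∑ σ : Equiv.Perm (Fin n),
            (X none : MvPolynomial (Option (Fin n × Fin n)) ℤ) ^
                (univ.filter (fun p : Fin n × Fin n => p.1 < p.2 ∧ σ p.2 < σ p.1)).card *
              ∏ i : Fin n, X (some (σ i, i))) + 2) + 1 := VP0Collapse.tau_jet_le_pencil n k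
      _ ≤ (n + k + 2) ^ 2 * (a * (n + 1) ^ b + 2) + 1 := by gcongr; exact hab n
      _ ≤ (n + 2) ^ (a + b + 7) := VP0Collapse.bound_arith a b n k hk

/-- **A refutation of `stub_multiplierRemoval` proves `τ(P_n) ≠ n^{O(1)}`** for the explicit
`VNP⁰` family `P_n` (the inversion pencil, `UniformJet.isVNP0Family_pencil`) — an explicit
superpolynomial constant-free lower bound, in particular `VP⁰ ≠ VNP⁰`.
[cite: KoiranPerifel2011, Rem. 4] -/
theorem not_isPBounded_tau_pencil_of_not_multiplierRemoval
    (hMR : ¬ (let J := fun (n k : ℕ) => (∑ σ : Equiv.Perm (Fin n), MvPolynomial.C (((Equiv.Perm.sign σ : ℤˣ) : ℤ) * (((Finset.univ.filter (fun p : Fin n × Fin n => p.1 < p.2 ∧ σ p.2 < σ p.1)).card.choose k : ℕ) : ℤ)) * ∏ i : Fin n, MvPolynomial.X (σ i, i) : MvPolynomial (Fin n × Fin n) ℤ);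
      ∃ b₃ : ℕ, ∀ n k M : ℕ, k ≤ Nat.log 2 n → 1 ≤ M →
        Literature.Computability.AlgebraicComplexity.constantFreeComplexity (J n k) ≤
          (Literature.Computability.AlgebraicComplexity.constantFreeComplexity ((M : ℤ) • J n k) + n + 2) ^ b₃)) :
    ¬ IsPBounded fun n => constantFreeComplexity
      (∑ σ : Equiv.Perm (Fin n), (X none : MvPolynomial (Option (Fin n × Fin n)) ℤ) ^
          (univ.filter (fun p : Fin n × Fin n => p.1 < p.2 ∧ σ p.2 < σ p.1)).card *
        ∏ i : Fin n, X (some (σ i, i))) := by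
  intro hP
  obtain ⟨c, hc⟩ := uniformTau_of_isPBounded_tau_pencil hP
  exact hMR (multiplierRemoval_iff_jet.mpr
    ⟨c, fun n k M _ _ => (hc n k).trans (Nat.pow_le_pow_left (by omega) _)⟩)

/-- **`ConstantFreeJetGrowth ⟹ τ(P_n) ≠ n^{O(1)}`**: the aside crux `CF` (and hence the residual
`CF^ult`, and `PerModPowBooleanHard`) proves that the inversion pencil — a `VNP⁰` family — is not
constant-free cheap. [cite: Burgisser2006, Def. 2.8] -/
theorem not_isPBounded_tau_pencil_of_constantFreeJetGrowth (hCF : ConstantFreeJetGrowth) :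
    ¬ IsPBounded fun n => constantFreeComplexity
      (∑ σ : Equiv.Perm (Fin n), (X none : MvPolynomial (Option (Fin n × Fin n)) ℤ) ^
          (univ.filter (fun p : Fin n × Fin n => p.1 < p.2 ∧ σ p.2 < σ p.1)).card *
        ∏ i : Fin n, X (some (σ i, i))) := by
  intro hP
  obtain ⟨c, hc⟩ := uniformTau_of_isPBounded_tau_pencil hP
  exact not_constantFreeJetGrowth_of_uniformTau ⟨c, fun n k _ => hc n k⟩ hCF

/-! ### Consequences for the route items (by name) -/

/-- **`VP⁰ = VNP⁰ ⟹ stub_multiplierRemoval`** (signature verbatim): with `τ(J_(n,k)) ≤ (n+2)^c`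
the stub's right-hand side `(τ(M·J) + n + 2)^c ≥ (n+2)^c` already dominates.  Contrapositive:
`not_vp0EqVNP0_of_not_multiplierRemoval`. [cite: KoiranPerifel2011, Rem. 4] -/
theorem multiplierRemoval_of_vp0EqVNP0 (h : VP0EqVNP0) :
    let J := fun (n k : ℕ) => (∑ σ : Equiv.Perm (Fin n), MvPolynomial.C (((Equiv.Perm.sign σ : ℤˣ) : ℤ) * (((Finset.univ.filter (fun p : Fin n × Fin n => p.1 < p.2 ∧ σ p.2 < σ p.1)).card.choose k : ℕ) : ℤ)) * ∏ i : Fin n, MvPolynomial.X (σ i, i) : MvPolynomial (Fin n × Fin n) ℤ);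
    ∃ b₃ : ℕ, ∀ n k M : ℕ, k ≤ Nat.log 2 n → 1 ≤ M →
      Literature.Computability.AlgebraicComplexity.constantFreeComplexity (J n k) ≤
        (Literature.Computability.AlgebraicComplexity.constantFreeComplexity ((M : ℤ) • J n k) + n + 2) ^ b₃ := by
  refine multiplierRemoval_iff_jet.mpr ?_
  obtain ⟨c, hc⟩ := uniformTau_of_vp0EqVNP0 h
  exact ⟨c, fun n k M _ _ => (hc n k).trans (Nat.pow_le_pow_left (by omega) _)⟩

/-- **`VP⁰ = VNP⁰ ⟹ JetConstantElim`** (item stmt-16737, the aside crux as filed).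
[cite: KoiranPerifel2011, Rem. 4] -/
theorem jetConstantElim_of_vp0EqVNP0 (h : VP0EqVNP0) : JetConstantElim := by
  rw [jetConstantElim_iff_jet]
  obtain ⟨c, hc⟩ := uniformTau_of_vp0EqVNP0 h
  exact ⟨c, fun n k _ => (hc n k).trans (Nat.pow_le_pow_left (by omega) _)⟩

/-- **`VP⁰ = VNP⁰ ⟹ JetConstantElimTwoAdic`** (item stmt-23655, the binder of the re-glued
`closes`; via `CE ⟹ CE^ult₂`). [cite: KoiranPerifel2011, Rem. 4] -/
theorem jetConstantElimTwoAdic_of_vp0EqVNP0 (h : VP0EqVNP0) : JetConstantElimTwoAdic :=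
  jetConstantElimTwoAdic_of_jetConstantElim (jetConstantElim_of_vp0EqVNP0 h)

/-- **`VP⁰ = VNP⁰ ⟹ ¬ConstantFreeJetGrowth`** (item stmt-16738): a uniform constant-free bound
on the window refutes constant-free jet growth (`not_constantFreeJetGrowth_of_uniformTau`).
[cite: Burgisser2006, Def. 2.7] -/
theorem not_constantFreeJetGrowth_of_vp0EqVNP0 (h : VP0EqVNP0) : ¬ ConstantFreeJetGrowth := by
  obtain ⟨c, hc⟩ := uniformTau_of_vp0EqVNP0 h
  exact not_constantFreeJetGrowth_of_uniformTau ⟨c, fun n k _ => hc n k⟩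

/-- **`VP⁰ = VNP⁰ ⟹ ¬ConstantFreeJetGrowthUltimate`** (item stmt-23656, the residual crux;
`CF^ult ⟹ CF`). [cite: Burgisser2006, Def. 2.7] -/
theorem not_constantFreeJetGrowthUltimate_of_vp0EqVNP0 (h : VP0EqVNP0) :
    ¬ ConstantFreeJetGrowthUltimate :=
  fun hCF => not_constantFreeJetGrowth_of_vp0EqVNP0 h (constantFreeJetGrowth_of_ultimate' hCF)

/-- **`VP⁰ = VNP⁰ ⟹ ¬PerModPowBooleanHard`** (support stmt-16743, the Boolean far side;
`PMPBH ⟹ CF^ult`). [cite: Burgisser2000TCS, §5 (A3)] -/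
theorem not_perModPowBooleanHard_of_vp0EqVNP0 (h : VP0EqVNP0) : ¬ PerModPowBooleanHard :=
  fun hH => not_constantFreeJetGrowthUltimate_of_vp0EqVNP0 h
    (constantFreeJetGrowthUltimate_of_perModPowBooleanHard hH)

/-! ### Contrapositives: what a refutation / a proof of the route's items would PROVE -/

/-- **A refutation of `stub_multiplierRemoval` proves `VP⁰ ≠ VNP⁰`** (the UPPER lock of the
stub; the LOWER lock is `not_isPBounded_tau_per_of_multiplierRemoval_of_cfGrowth`:
`MR ∧ CF ⊢ τ(PER) ≠ n^{O(1)}`). [cite: KoiranPerifel2011, Rem. 4] -/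
theorem not_vp0EqVNP0_of_not_multiplierRemoval
    (hMR : ¬ (let J := fun (n k : ℕ) => (∑ σ : Equiv.Perm (Fin n), MvPolynomial.C (((Equiv.Perm.sign σ : ℤˣ) : ℤ) * (((Finset.univ.filter (fun p : Fin n × Fin n => p.1 < p.2 ∧ σ p.2 < σ p.1)).card.choose k : ℕ) : ℤ)) * ∏ i : Fin n, MvPolynomial.X (σ i, i) : MvPolynomial (Fin n × Fin n) ℤ);
      ∃ b₃ : ℕ, ∀ n k M : ℕ, k ≤ Nat.log 2 n → 1 ≤ M →
        Literature.Computability.AlgebraicComplexity.constantFreeComplexity (J n k) ≤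
          (Literature.Computability.AlgebraicComplexity.constantFreeComplexity ((M : ℤ) • J n k) + n + 2) ^ b₃)) :
    ¬ VP0EqVNP0 :=
  fun h => hMR (multiplierRemoval_of_vp0EqVNP0 h)

/-- **A refutation of the crux `JetConstantElim` (stmt-16737) proves `VP⁰ ≠ VNP⁰`.**
[cite: KoiranPerifel2011, Rem. 4] -/
theorem not_vp0EqVNP0_of_not_jetConstantElim (hCE : ¬ JetConstantElim) : ¬ VP0EqVNP0 :=
  fun h => hCE (jetConstantElim_of_vp0EqVNP0 h)

/-- **A refutation of the binder `JetConstantElimTwoAdic` (stmt-23655) proves `VP⁰ ≠ VNP⁰`.**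
[cite: KoiranPerifel2011, Rem. 4] -/
theorem not_vp0EqVNP0_of_not_jetConstantElimTwoAdic (hCE : ¬ JetConstantElimTwoAdic) :
    ¬ VP0EqVNP0 :=
  fun h => hCE (jetConstantElimTwoAdic_of_vp0EqVNP0 h)

/-- **The aside crux `ConstantFreeJetGrowth` (stmt-16738) alone proves `VP⁰ ≠ VNP⁰`** — although
every fixed jet is in `VP⁰` (`JetFlatness`), `k`-uniform constant-free growth on the explicit easy
families already separates the constant-free classes. [cite: Burgisser2006, Def. 2.7] -/
theorem not_vp0EqVNP0_of_constantFreeJetGrowth (hCF : ConstantFreeJetGrowth) : ¬ VP0EqVNP0 :=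
  fun h => not_constantFreeJetGrowth_of_vp0EqVNP0 h hCF

/-- **The residual crux `ConstantFreeJetGrowthUltimate` (stmt-23656) proves `VP⁰ ≠ VNP⁰`.**
[cite: Burgisser2006, Def. 2.7] -/
theorem not_vp0EqVNP0_of_constantFreeJetGrowthUltimate (hCF : ConstantFreeJetGrowthUltimate) :
    ¬ VP0EqVNP0 :=
  fun h => not_constantFreeJetGrowthUltimate_of_vp0EqVNP0 h hCF

end Summit.ValiantsHypothesis.ValiantsHypothesis.Theorems.AnyonJets.JetConstantElim

end
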